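import Mathlib
import Summits.NavierStokesRegularity.NavierStokesRegularity.Theorems.EulerZoomLiouvillePowerGaugeEulerLiouvilleSelfSimilarFiniteNodalSetExclusion
import Summits.NavierStokesRegularity.NavierStokesRegularity.Theorems.EulerZoomLiouvillePowerGaugeEulerLiouvilleSelfSimilarExpSplitting
import Summits.NavierStokesRegularity.NavierStokesRegularity.Theorems.EulerZoomLiouvillePowerGaugeEulerLiouvilleNeedleStagnationHosts

/-!
# STABLE DIRECTIONS AT STAGNATION NODES (ROUND-41 THEOREM A chain, file 1; nsreg-p2 R41 §1 (E3)/(E4))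

Width piece for crux `EulerZoomLiouville.PowerGaugeEulerLiouville` (stmt-NavierStokesRegularity-19832), by name under
LEAD 19832 (ns-typeII-p2); seat ns-ezl-w2 g4 (lane T5, α-limit assemblies), `--supports … --as helper`.  The linear algebra
feeding the landed fact-free (IM1) `Literature.Dynamics.FixedPoints.unstableSetNull_of_stableDirection` (backward basin of
a rest point with a STABLE DIRECTION — some `v ≠ 0` with `exp(t·DF(z)) v → 0` — is Lebesgue-null).  For a `C²`
self-similar Euler profile `(U, P)`, `γ < ½`, wind `W = γ(y − c) + U`, node `z` (`W z = 0`), `M = DW(z) = γI + DU(z)`: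

* `tendsto_exp_smul_apply_of_eigenvector_neg` — an eigenvector with a negative eigenvalue is a stable direction
  (Grönwall on the eigenline, tree `Kelvin.inner_exp_smul_apply_le`);
* `exists_stableDirection_of_planar_block` — `M` leaving the plane `span{b₁, b₂}` of an orthonormal frame invariant with a
  `2 × 2` block of NEGATIVE TRACE has `v ≠ 0` in the plane with `exp(tM)v → 0` (real eigenvalues: the smaller is `< 0`;
  complex pair: an adapted positive form `G` with `⟪G(Mh), h⟫ = (tr/2)⟪Gh, h⟫` makes the whole plane decay);
* **`exists_stableDirection_of_vortical_stagnation`** — VORTICAL node: `M Ω = (1+γ)Ω`, `Ω^⊥` invariant with trace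
  `2γ − 1 < 0` (R41 (E3)(a): `λ₂ + λ₃ = −ργ`) ⇒ a stable direction;
* `stableDirection_or_nonneg_of_isSymmetric` / **`stableDirection_or_nonneg_of_curl_eq_zero`** — NON-VORTICAL point:
  `M` symmetric ⇒ a negative eigenvalue (stable direction) OR `M ⪰ 0` (a SOURCE of `W`);
* **`stableDirection_or_source_of_mem_nodalSet`** — THE HOST DICHOTOMY at every node of an in-window profile: a stable
  direction for `DW(z)`, or `curl U z = 0 ∧ DW(z) ⪰ 0 ∧ ∀ w, ⟪DU(z)w, w⟫ ≤ 2γ‖w‖²` (t41a).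

HONEST FRAMING: linear algebra / linear ODE for HYPOTHETICAL self-similar Euler profiles (MODEL lattice of the crux class);
proves nothing about the crux E (19832 OPEN), any door Target, or Navier–Stokes regularity; no summit statement is touched.
[folklore; cf. ConstantinIgnatovaVicol2026Putative §3.5 Thms 3.8–3.10; Teschl2012 §3.2 Thm 3.4]
-/

noncomputable section

set_option linter.dupNamespace false

open Set Filter Topology Metric Function InnerProductSpace
open scoped RealInnerProductSpace

namespace Summit.NavierStokesRegularity.NavierStokesRegularity.Theorems.PowerGaugeEulerLiouville.Stagnation

open Literature.Analysis Literature.Analysis.FluidPDE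
open Summit.NavierStokesRegularity.NavierStokesRegularity.Theorems.PowerGaugeEulerLiouville

/-! ### Eigenlines with a negative eigenvalue are stable directions -/

/-- **An eigenvector with a negative eigenvalue is a stable direction**: `M v = r v`, `r < 0` ⇒ `exp(tM) v → 0` as
`t → ∞` (indeed `‖exp(tM)v‖ ≤ e^{rt}‖v‖`, Grönwall on the invariant line `ℝv` with the Euclidean Lyapunov pair).
[folklore; cf. Teschl2012 §3.2 Thm 3.4] -/
theorem tendsto_exp_smul_apply_of_eigenvector_neg
    (M : EuclideanSpace ℝ (Fin 3) →L[ℝ] EuclideanSpace ℝ (Fin 3)) {v : EuclideanSpace ℝ (Fin 3)} {r : ℝ}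
    (hMv : M v = r • v) (hr : r < 0) :
    Tendsto (fun t : ℝ => NormedSpace.exp (t • M) v) atTop (𝓝 0) := by
  set S : Submodule ℝ (EuclideanSpace ℝ (Fin 3)) := Submodule.span ℝ {v} with hS
  have hSinv : ∀ x ∈ S, M x ∈ S := by
    intro x hx
    obtain ⟨a, rfl⟩ := Submodule.mem_span_singleton.1 hx
    rw [map_smul, hMv, smul_smul]
    exact Submodule.mem_span_singleton.2 ⟨a * r, rfl⟩
  have hle : ∀ h ∈ S, ⟪(ContinuousLinearMap.id ℝ _) (M h), h⟫ ≤
      -(-r) * ⟪(ContinuousLinearMap.id ℝ _) h, h⟫ := by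
    intro h hh
    obtain ⟨a, rfl⟩ := Submodule.mem_span_singleton.1 hh
    rw [ContinuousLinearMap.id_apply, ContinuousLinearMap.id_apply, map_smul, hMv, smul_smul,
      real_inner_smul_left, real_inner_smul_left, real_inner_smul_right]
    exact le_of_eq (by ring)
  have hv : v ∈ S := Submodule.mem_span_singleton_self v
  have hbound : ∀ t : ℝ, 0 ≤ t → ‖NormedSpace.exp (t • M) v‖ ≤ Real.exp (r * t) * ‖v‖ := by
    intro t ht
    have h := Kelvin.inner_exp_smul_apply_le M (ContinuousLinearMap.id ℝ _) hSinv (fun u w => by simp) hle hv ht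
    rw [ContinuousLinearMap.id_apply, ContinuousLinearMap.id_apply, real_inner_self_eq_norm_sq,
      real_inner_self_eq_norm_sq] at h
    have h2 : ‖NormedSpace.exp (t • M) v‖ ^ 2 ≤ (Real.exp (r * t) * ‖v‖) ^ 2 := by
      calc ‖NormedSpace.exp (t • M) v‖ ^ 2 ≤ Real.exp (-(2 * -r) * t) * ‖v‖ ^ 2 := h
        _ = (Real.exp (r * t) * ‖v‖) ^ 2 := by rw [mul_pow, ← Real.exp_nat_mul]; ring_nf
    exact (pow_le_pow_iff_left₀ (norm_nonneg _) (by positivity) two_ne_zero).1 h2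
  have hlim : Tendsto (fun t : ℝ => Real.exp (r * t) * ‖v‖) atTop (𝓝 0) := by
    have h1 : Tendsto (fun t : ℝ => Real.exp (r * t)) atTop (𝓝 0) :=
      Real.tendsto_exp_atBot.comp ((tendsto_const_mul_atBot_of_neg hr).2 tendsto_id)
    simpa using h1.mul_const ‖v‖
  exact squeeze_zero_norm' (Filter.eventually_of_mem (Ici_mem_atTop 0) fun t ht => hbound t ht) hlim

/-! ### A planar block of negative trace has a stable direction -/

/-- **Planar block with negative trace ⇒ a stable direction** (pure linear algebra on `ℝ³`).  Let `b` be an orthonormal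
frame and `M` an operator leaving `span{b₁, b₂}` invariant, `M b₁ = a₁₁b₁ + a₂₁b₂`, `M b₂ = a₁₂b₁ + a₂₂b₂`, with
`a₁₁ + a₂₂ < 0`.  Then some `v ≠ 0` in the plane has `exp(tM)v → 0`.  Real eigenvalues (`(a₁₁−a₂₂)² + 4a₁₂a₂₁ ≥ 0`): the
smaller one `r = (tr − √disc)/2 < 0` has an explicit eigenvector; complex pair: with `d = (a₁₁−a₂₂)/2` the positive form
`p x₁² + 2q x₁x₂ + s x₂²`, `(p, q, s) = (a₂₁², −a₂₁d, −a₂₁a₁₂)`, satisfies `⟪G(Mh), h⟫ = ((a₁₁+a₂₂)/2)⟪Gh, h⟫` on the plane,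
so the whole plane decays (Grönwall, `Kelvin.inner_exp_smul_apply_le`). [folklore; cf. Teschl2012 §3.2 Thm 3.4] -/
theorem exists_stableDirection_of_planar_block (b : OrthonormalBasis (Fin 3) ℝ (EuclideanSpace ℝ (Fin 3)))
    (M : EuclideanSpace ℝ (Fin 3) →L[ℝ] EuclideanSpace ℝ (Fin 3)) {a₁₁ a₁₂ a₂₁ a₂₂ : ℝ}
    (h1 : M (b 1) = a₁₁ • b 1 + a₂₁ • b 2) (h2 : M (b 2) = a₁₂ • b 1 + a₂₂ • b 2) (htr : a₁₁ + a₂₂ < 0) :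
    ∃ v : EuclideanSpace ℝ (Fin 3), v ≠ 0 ∧ Tendsto (fun t : ℝ => NormedSpace.exp (t • M) v) atTop (𝓝 0) := by
  have hon : ∀ i j : Fin 3, ⟪b i, b j⟫ = if i = j then (1 : ℝ) else 0 := fun i j =>
    orthonormal_iff_ite.1 b.orthonormal i j
  have hb1 : b 1 ≠ 0 := b.orthonormal.ne_zero 1
  have hb2 : b 2 ≠ 0 := b.orthonormal.ne_zero 2
  -- the action of `M` on the plane, in coordinates
  have hMx : ∀ x₁ x₂ : ℝ, M (x₁ • b 1 + x₂ • b 2) =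
      (a₁₁ * x₁ + a₁₂ * x₂) • b 1 + (a₂₁ * x₁ + a₂₂ * x₂) • b 2 := by
    intro x₁ x₂
    rw [map_add, map_smul, map_smul, h1, h2]
    module
  have hc0 : ∀ x₁ x₂ : ℝ, ⟪b 0, x₁ • b 1 + x₂ • b 2⟫ = 0 := by
    intro x₁ x₂; rw [inner_add_right, inner_smul_right, inner_smul_right, hon, hon]; simp
  have hc1 : ∀ x₁ x₂ : ℝ, ⟪b 1, x₁ • b 1 + x₂ • b 2⟫ = x₁ := by
    intro x₁ x₂; rw [inner_add_right, inner_smul_right, inner_smul_right, hon, hon]; simp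
  have hc2 : ∀ x₁ x₂ : ℝ, ⟪b 2, x₁ • b 1 + x₂ • b 2⟫ = x₂ := by
    intro x₁ x₂; rw [inner_add_right, inner_smul_right, inner_smul_right, hon, hon]; simp
  have hne1 : ∀ x₁ x₂ : ℝ, x₁ ≠ 0 → x₁ • b 1 + x₂ • b 2 ≠ 0 := fun x₁ x₂ hx h0 => by
    have e := hc1 x₁ x₂; rw [h0, inner_zero_right] at e; exact hx e.symm
  have hne2 : ∀ x₁ x₂ : ℝ, x₂ ≠ 0 → x₁ • b 1 + x₂ • b 2 ≠ 0 := fun x₁ x₂ hx h0 => by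
    have e := hc2 x₁ x₂; rw [h0, inner_zero_right] at e; exact hx e.symm
  rcases lt_or_ge ((a₁₁ - a₂₂) ^ 2 + 4 * (a₁₂ * a₂₁)) 0 with hDneg | hDnn
  · /- COMPLEX PAIR: `a₁₂a₂₁ < 0`; the adapted form `p x₁² + 2q x₁x₂ + s x₂²` (and `c₀ x₀²` off the plane) is a Lyapunov
    function with the exact rate `a₁₁ + a₂₂` on the invariant plane. -/
    have h1221 : a₁₂ * a₂₁ < 0 := by nlinarith [sq_nonneg (a₁₁ - a₂₂)]
    have h21 : a₂₁ ≠ 0 := by rintro h; rw [h, mul_zero] at h1221; exact lt_irrefl _ h1221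
    obtain ⟨d, hd⟩ : ∃ d : ℝ, d = (a₁₁ - a₂₂) / 2 := ⟨_, rfl⟩
    obtain ⟨p, hp⟩ : ∃ p : ℝ, p = a₂₁ ^ 2 := ⟨_, rfl⟩
    obtain ⟨q, hq⟩ : ∃ q : ℝ, q = -(a₂₁ * d) := ⟨_, rfl⟩
    obtain ⟨s, hs⟩ : ∃ s : ℝ, s = -(a₂₁ * a₁₂) := ⟨_, rfl⟩
    have hp0 : 0 < p := by rw [hp]; exact lt_of_le_of_ne (sq_nonneg _) (Ne.symm (pow_ne_zero 2 h21))
    have hs0 : 0 < s := by rw [hs]; linarith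
    have hdet : 0 < p * s - q ^ 2 := by
      have e : p * s - q ^ 2 = a₂₁ ^ 2 * (-((a₁₁ - a₂₂) ^ 2 + 4 * (a₁₂ * a₂₁)) / 4) := by
        rw [hp, hs, hq, hd]; ring
      rw [e]
      exact mul_pos (by rw [← hp]; exact hp0) (by linarith)
    obtain ⟨c₀, hc₀⟩ : ∃ c₀ : ℝ, c₀ = (p * s - q ^ 2) / (p + s) := ⟨_, rfl⟩
    have hc₀pos : 0 < c₀ := by rw [hc₀]; positivity
    -- the binary form dominates `c₀ (x₁² + x₂²)`
    have hform : ∀ x₁ x₂ : ℝ, c₀ * (x₁ ^ 2 + x₂ ^ 2) ≤ p * x₁ ^ 2 + 2 * q * (x₁ * x₂) + s * x₂ ^ 2 := by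
      intro x₁ x₂
      rw [hc₀, div_mul_eq_mul_div, div_le_iff₀ (by positivity)]
      nlinarith [sq_nonneg (p * x₁ + q * x₂), sq_nonneg (q * x₁ + s * x₂)]
    let G : EuclideanSpace ℝ (Fin 3) →L[ℝ] EuclideanSpace ℝ (Fin 3) :=
      c₀ • (innerSL ℝ (b 0)).smulRight (b 0) +
        (p • (innerSL ℝ (b 1)).smulRight (b 1) + q • (innerSL ℝ (b 2)).smulRight (b 1)) +
        (q • (innerSL ℝ (b 1)).smulRight (b 2) + s • (innerSL ℝ (b 2)).smulRight (b 2))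
    have hG : ∀ u, G u = (c₀ * ⟪b 0, u⟫) • b 0 + (p * ⟪b 1, u⟫ + q * ⟪b 2, u⟫) • b 1 +
        (q * ⟪b 1, u⟫ + s * ⟪b 2, u⟫) • b 2 := by
      intro u
      simp only [G, _root_.add_apply, FunLike.coe_smul, Pi.smul_apply,
        ContinuousLinearMap.smulRight_apply, innerSL_apply_apply]
      module
    have hGinner : ∀ u w, ⟪G u, w⟫ = c₀ * ⟪b 0, u⟫ * ⟪b 0, w⟫ + (p * ⟪b 1, u⟫ + q * ⟪b 2, u⟫) * ⟪b 1, w⟫ +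
        (q * ⟪b 1, u⟫ + s * ⟪b 2, u⟫) * ⟪b 2, w⟫ := by
      intro u w
      rw [hG]
      simp only [inner_add_left, real_inner_smul_left]
    have hGsym : ∀ u w, ⟪G u, w⟫ = ⟪u, G w⟫ := by
      intro u w
      rw [real_inner_comm (G w) u, hGinner, hGinner]
      ring
    have hnorm : ∀ u : EuclideanSpace ℝ (Fin 3), ‖u‖ ^ 2 = ⟪b 0, u⟫ ^ 2 + ⟪b 1, u⟫ ^ 2 + ⟪b 2, u⟫ ^ 2 := by
      intro u
      rw [← real_inner_self_eq_norm_sq, ← b.sum_inner_mul_inner u u, Fin.sum_univ_three,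
        real_inner_comm u (b 0), real_inner_comm u (b 1), real_inner_comm u (b 2)]
      ring
    have hcoer : ∀ u : EuclideanSpace ℝ (Fin 3), c₀ * ‖u‖ ^ 2 ≤ ⟪G u, u⟫ := by
      intro u
      rw [hGinner, hnorm]
      have := hform ⟪b 1, u⟫ ⟪b 2, u⟫
      nlinarith [sq_nonneg ⟪b 0, u⟫, hc₀pos]
    set Spl : Submodule ℝ (EuclideanSpace ℝ (Fin 3)) := Submodule.span ℝ {b 1, b 2} with hSpl
    have hSinv : ∀ x ∈ Spl, M x ∈ Spl := by
      intro x hx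
      obtain ⟨x₁, x₂, rfl⟩ := Submodule.mem_span_pair.1 hx
      rw [hMx]
      exact Submodule.mem_span_pair.2 ⟨_, _, rfl⟩
    have hb1S : b 1 ∈ Spl := Submodule.mem_span_pair.2 ⟨1, 0, by simp⟩
    -- the exact Lyapunov rate on the plane
    have hkey : ∀ h ∈ Spl, ⟪G (M h), h⟫ ≤ -(-((a₁₁ + a₂₂) / 2)) * ⟪G h, h⟫ := by
      intro h hh
      obtain ⟨x₁, x₂, rfl⟩ := Submodule.mem_span_pair.1 hh
      rw [hMx, hGinner, hGinner, hc0, hc0, hc1, hc1, hc2, hc2]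
      apply le_of_eq
      rw [hp, hq, hs, hd]
      ring
    refine ⟨b 1, hb1, ?_⟩
    have hsq : ∀ t : ℝ, 0 ≤ t →
        ‖NormedSpace.exp (t • M) (b 1)‖ ^ 2 ≤ Real.exp ((a₁₁ + a₂₂) * t) * (⟪G (b 1), b 1⟫ / c₀) := by
      intro t ht
      have h := Kelvin.inner_exp_smul_apply_le M G hSinv hGsym hkey hb1S ht
      have e : -(2 * -((a₁₁ + a₂₂) / 2)) * t = (a₁₁ + a₂₂) * t := by ring
      rw [e] at h
      have h3 := (hcoer _).trans h
      rw [mul_div_assoc', le_div_iff₀ hc₀pos]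
      linarith
    have hlim : Tendsto (fun t : ℝ => Real.exp ((a₁₁ + a₂₂) * t) * (⟪G (b 1), b 1⟫ / c₀)) atTop (𝓝 0) := by
      have h1 : Tendsto (fun t : ℝ => Real.exp ((a₁₁ + a₂₂) * t)) atTop (𝓝 0) :=
        Real.tendsto_exp_atBot.comp ((tendsto_const_mul_atBot_of_neg htr).2 tendsto_id)
      simpa using h1.mul_const (⟪G (b 1), b 1⟫ / c₀)
    have hsq0 : Tendsto (fun t : ℝ => ‖NormedSpace.exp (t • M) (b 1)‖ ^ 2) atTop (𝓝 0) :=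
      squeeze_zero' (Filter.Eventually.of_forall fun t => sq_nonneg _)
        (Filter.eventually_of_mem (Ici_mem_atTop 0) fun t ht => hsq t ht) hlim
    rw [tendsto_zero_iff_norm_tendsto_zero]
    have h4 := hsq0.sqrt
    rw [Real.sqrt_zero] at h4
    refine h4.congr fun t => ?_
    rw [Real.sqrt_sq (norm_nonneg _)]
  · /- REAL EIGENVALUES: `r = ((a₁₁ + a₂₂) − √disc)/2 < 0` is a root of the characteristic polynomial of the block. -/
    set sD := Real.sqrt ((a₁₁ - a₂₂) ^ 2 + 4 * (a₁₂ * a₂₁)) with hsD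
    have hsD0 : 0 ≤ sD := Real.sqrt_nonneg _
    have hsD2 : sD ^ 2 = (a₁₁ - a₂₂) ^ 2 + 4 * (a₁₂ * a₂₁) := Real.sq_sqrt hDnn
    obtain ⟨r, hr⟩ : ∃ r : ℝ, r = ((a₁₁ + a₂₂) - sD) / 2 := ⟨_, rfl⟩
    have hrneg : r < 0 := by rw [hr]; linarith
    have hroot : r ^ 2 - (a₁₁ + a₂₂) * r + (a₁₁ * a₂₂ - a₁₂ * a₂₁) = 0 := by
      rw [hr]; linear_combination (1 / 4 : ℝ) * hsD2
    by_cases h12 : a₁₂ ≠ 0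
    · refine ⟨a₁₂ • b 1 + (r - a₁₁) • b 2, hne1 _ _ h12, ?_⟩
      apply tendsto_exp_smul_apply_of_eigenvector_neg M _ hrneg
      rw [hMx, smul_add, smul_smul, smul_smul]
      have e1 : a₁₁ * a₁₂ + a₁₂ * (r - a₁₁) = r * a₁₂ := by ring
      have e2 : a₂₁ * a₁₂ + a₂₂ * (r - a₁₁) = r * (r - a₁₁) := by linear_combination (-1 : ℝ) * hroot
      rw [e1, e2]
    · push Not at h12
      by_cases h21 : a₂₁ ≠ 0
      · refine ⟨(r - a₂₂) • b 1 + a₂₁ • b 2, hne2 _ _ h21, ?_⟩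
        apply tendsto_exp_smul_apply_of_eigenvector_neg M _ hrneg
        rw [hMx, smul_add, smul_smul, smul_smul]
        have e1 : a₁₁ * (r - a₂₂) + a₁₂ * a₂₁ = r * (r - a₂₂) := by linear_combination (-1 : ℝ) * hroot
        have e2 : a₂₁ * (r - a₂₂) + a₂₂ * a₂₁ = r * a₂₁ := by ring
        rw [e1, e2]
      · push Not at h21
        -- diagonal block: one of the two diagonal entries is negative
        rcases lt_or_ge a₁₁ 0 with ha | ha
        · refine ⟨b 1, hb1, tendsto_exp_smul_apply_of_eigenvector_neg M ?_ ha⟩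
          rw [h1, h21, zero_smul, add_zero]
        · have ha2 : a₂₂ < 0 := by linarith
          refine ⟨b 2, hb2, tendsto_exp_smul_apply_of_eigenvector_neg M ?_ ha2⟩
          rw [h2, h12, zero_smul, zero_add]

/-! ### Vortical stagnation nodes have a stable direction -/

variable {γ : ℝ} {c : EuclideanSpace ℝ (Fin 3)}
  {U : EuclideanSpace ℝ (Fin 3) → EuclideanSpace ℝ (Fin 3)} {P : EuclideanSpace ℝ (Fin 3) → ℝ}

/-- **A VORTICAL stagnation node has a stable direction (R41 (E3)(a)).**  `(U, P)` a self-similar Euler profile with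
`γ < ½`, `z` a stagnation point of `W = γ(y−c) + U` with `Ω(z) = curl U z ≠ 0`.  With `ξ = Ω(z)/|Ω(z)|`:
`DW(z)ξ = (1+γ)ξ` (`DU(z)Ω(z) = Ω(z)`), the plane `ξ^⊥` is `DW(z)`-invariant (the antisymmetric part of `DU(z)` is
`½Ω(z)×·`, `NodalFiniteness.inner_fderiv_comm_of_parallel_curl`) and its block has trace `3γ − (1+γ) = 2γ − 1 < 0`
(`div U = 0`); so `exists_stableDirection_of_planar_block` gives `v ≠ 0` with `exp(t·DW(z))v → 0`.
[folklore; cf. ConstantinIgnatovaVicol2026Putative §3.5 proof of Thm 3.8] -/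
theorem exists_stableDirection_of_vortical_stagnation (h : IsSelfSimilarEulerProfile γ c U P) (hγ2 : γ < 1 / 2)
    {z : EuclideanSpace ℝ (Fin 3)} (hz : z ∈ selfSimilarNodalSet γ c U) (hΩz : curl U z ≠ 0) :
    ∃ v : EuclideanSpace ℝ (Fin 3), v ≠ 0 ∧
      Tendsto (fun t : ℝ => NormedSpace.exp (t • fderiv ℝ (selfSimilarTransport γ c U) z) v) atTop (𝓝 0) := by
  have hUd := h.differentiable_velocity
  set M := fderiv ℝ (selfSimilarTransport γ c U) z with hMdef
  have hDV : M = γ • ContinuousLinearMap.id ℝ _ + fderiv ℝ U z :=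
    (FluidPDE.hasFDerivAt_selfSimilarTransport hUd z).fderiv
  have hMv : ∀ v, M v = γ • v + fderiv ℝ U z v := fun v => by
    rw [hDV]; rfl
  set mΩ : ℝ := ‖curl U z‖ with hmΩ
  have hmpos : 0 < mΩ := norm_pos_iff.2 hΩz
  set ξ : EuclideanSpace ℝ (Fin 3) := mΩ⁻¹ • curl U z with hξ
  have hξ1 : ‖ξ‖ = 1 := by
    rw [hξ, norm_smul, norm_inv, norm_norm, inv_mul_cancel₀ hmpos.ne']
  have hDUξ : fderiv ℝ U z ξ = ξ := by
    rw [hξ, map_smul, h.isSelfSimilarEulerVorticityProfile.fderiv_apply_curl_eq_of_mem_nodalSet hz]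
  have hMξ : M ξ = (1 + γ) • ξ := by rw [hMv, hDUξ, add_smul, one_smul, add_comm]
  obtain ⟨w₁, w₂, hw₁, hw₂, hw₁₂, hξw₁, hξw₂⟩ := Convexity.exists_orthonormal_pair_perp ξ
  set f : Fin 3 → EuclideanSpace ℝ (Fin 3) := ![ξ, w₁, w₂] with hf
  have hw₁ξ : ⟪w₁, ξ⟫ = 0 := by rw [real_inner_comm]; exact hξw₁
  have hw₂ξ : ⟪w₂, ξ⟫ = 0 := by rw [real_inner_comm]; exact hξw₂
  have hw₂₁ : ⟪w₂, w₁⟫ = 0 := by rw [real_inner_comm]; exact hw₁₂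
  have hfon : Orthonormal ℝ f := by
    rw [orthonormal_iff_ite]
    intro i j
    fin_cases i <;> fin_cases j <;>
      simp [hf, hξ1, hw₁, hw₂, hw₁₂, hξw₁, hξw₂, hw₁ξ, hw₂ξ, hw₂₁]
  have hcard : Fintype.card (Fin 3) = Module.finrank ℝ (EuclideanSpace ℝ (Fin 3)) := by simp
  set b : OrthonormalBasis (Fin 3) ℝ (EuclideanSpace ℝ (Fin 3)) :=
    (basisOfOrthonormalOfCardEqFinrank hfon hcard).toOrthonormalBasis
      (by rw [coe_basisOfOrthonormalOfCardEqFinrank]; exact hfon) with hb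
  have hb_apply : ∀ i, b i = f i := fun i => by
    rw [hb, Module.Basis.coe_toOrthonormalBasis, coe_basisOfOrthonormalOfCardEqFinrank]
  have hb0 : b 0 = ξ := by rw [hb_apply]; rfl
  have hb1 : b 1 = w₁ := by rw [hb_apply]; rfl
  have hb2 : b 2 = w₂ := by rw [hb_apply]; rfl
  have hinv : ∀ w, ⟪ξ, w⟫ = 0 → ⟪ξ, M w⟫ = 0 := by
    intro w hw
    rw [hMv, inner_add_right, inner_smul_right, hw, mul_zero, zero_add]
    have e1 : ⟪fderiv ℝ U z ξ, w⟫ = ⟪fderiv ℝ U z w, ξ⟫ := NodalFiniteness.inner_fderiv_comm_of_parallel_curl w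
    rw [hDUξ] at e1
    rw [real_inner_comm, ← e1, hw]
  have hexpand : ∀ v : EuclideanSpace ℝ (Fin 3), v = ⟪ξ, v⟫ • ξ + ⟪w₁, v⟫ • w₁ + ⟪w₂, v⟫ • w₂ := by
    intro v
    conv_lhs => rw [← b.sum_repr' v]
    rw [Fin.sum_univ_three, hb0, hb1, hb2]
  have hMw₁ : M w₁ = ⟪w₁, M w₁⟫ • w₁ + ⟪w₂, M w₁⟫ • w₂ := by
    have e := hexpand (M w₁); rw [hinv w₁ hξw₁, zero_smul, zero_add] at e; exact e
  have hMw₂ : M w₂ = ⟪w₁, M w₂⟫ • w₁ + ⟪w₂, M w₂⟫ • w₂ := by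
    have e := hexpand (M w₂); rw [hinv w₂ hξw₂, zero_smul, zero_add] at e; exact e
  -- trace bookkeeping: `⟪w₁,Mw₁⟫ + ⟪w₂,Mw₂⟫ = 3γ − (1+γ) = 2γ − 1 < 0`
  have htrM : LinearMap.trace ℝ _ (M : EuclideanSpace ℝ (Fin 3) →ₗ[ℝ] EuclideanSpace ℝ (Fin 3)) =
      3 * γ := by
    have hdiv : LinearMap.trace ℝ _ (fderiv ℝ U z :
        EuclideanSpace ℝ (Fin 3) →ₗ[ℝ] EuclideanSpace ℝ (Fin 3)) = 0 := h.divFree z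
    rw [hDV, ContinuousLinearMap.toLinearMap_add, ContinuousLinearMap.toLinearMap_smul, map_add,
      map_smul, hdiv, ContinuousLinearMap.coe_id, LinearMap.trace_id, finrank_euclideanSpace,
      Fintype.card_fin]
    norm_num
    ring
  have htr' : ⟪w₁, M w₁⟫ + ⟪w₂, M w₂⟫ = 2 * γ - 1 := by
    have e := LinearMap.trace_eq_sum_inner (M : EuclideanSpace ℝ (Fin 3) →ₗ[ℝ] EuclideanSpace ℝ (Fin 3)) b
    rw [htrM, Fin.sum_univ_three, hb0, hb1, hb2] at e
    simp only [ContinuousLinearMap.coe_coe] at e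
    rw [hMξ, inner_smul_right, real_inner_self_eq_norm_sq, hξ1] at e
    linarith
  have htr : ⟪w₁, M w₁⟫ + ⟪w₂, M w₂⟫ < 0 := by rw [htr']; linarith
  have h1' : M (b 1) = ⟪w₁, M w₁⟫ • b 1 + ⟪w₂, M w₁⟫ • b 2 := by rw [hb1, hb2]; exact hMw₁
  have h2' : M (b 2) = ⟪w₁, M w₂⟫ • b 1 + ⟪w₂, M w₂⟫ • b 2 := by rw [hb1, hb2]; exact hMw₂
  exact exists_stableDirection_of_planar_block b M h1' h2' htr

/-! ### Non-vortical points: a stable direction or a source -/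

/-- **Symmetric operators on `ℝ³`: a negative eigenvalue (stable direction) or positive semi-definite.**  Spectral theorem
(Mathlib `LinearMap.IsSymmetric.eigenvectorBasis`): if some eigenvalue is `< 0` its eigenvector is a stable direction
(`tendsto_exp_smul_apply_of_eigenvector_neg`); otherwise `⟪Mw, w⟫ = Σ λᵢ⟪bᵢ, w⟫² ≥ 0`. [folklore] -/
theorem stableDirection_or_nonneg_of_isSymmetric (M : EuclideanSpace ℝ (Fin 3) →L[ℝ] EuclideanSpace ℝ (Fin 3))
    (hM : (M : EuclideanSpace ℝ (Fin 3) →ₗ[ℝ] EuclideanSpace ℝ (Fin 3)).IsSymmetric) :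
    (∃ v : EuclideanSpace ℝ (Fin 3), v ≠ 0 ∧ Tendsto (fun t : ℝ => NormedSpace.exp (t • M) v) atTop (𝓝 0)) ∨
      (∀ w : EuclideanSpace ℝ (Fin 3), 0 ≤ ⟪M w, w⟫) := by
  have hn : Module.finrank ℝ (EuclideanSpace ℝ (Fin 3)) = 3 := finrank_euclideanSpace_fin
  set b := hM.eigenvectorBasis hn with hb
  set ev : Fin 3 → ℝ := hM.eigenvalues hn with hev
  have hMb : ∀ i, M (b i) = ev i • b i := fun i => hM.apply_eigenvectorBasis hn i
  by_cases hneg : ∃ i, ev i < 0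
  · obtain ⟨i, hi⟩ := hneg
    exact Or.inl ⟨b i, b.orthonormal.ne_zero i, tendsto_exp_smul_apply_of_eigenvector_neg M (hMb i) hi⟩
  · push Not at hneg
    right
    intro w
    have hcoordM : ∀ i, ⟪b i, M w⟫ = ev i * ⟪b i, w⟫ := by
      intro i
      have hsym := hM (b i) w
      simp only [ContinuousLinearMap.coe_coe] at hsym
      rw [← hsym, hMb, real_inner_smul_left]
    have e : ⟪M w, w⟫ = ∑ i, ev i * (⟪b i, w⟫ * ⟪b i, w⟫) := by
      rw [← b.sum_inner_mul_inner (M w) w]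
      refine Finset.sum_congr rfl fun i _ => ?_
      rw [real_inner_comm (b i) (M w), hcoordM]; ring
    rw [e]
    exact Finset.sum_nonneg fun i _ => mul_nonneg (hneg i) (mul_self_nonneg _)

/-- **At a NON-VORTICAL point: a stable direction or a source.**  If `curl U z = 0` then `DU(z)` is symmetric
(`isSymmetric_fderiv_of_curl_eq_zero`), hence so is `DW(z) = γI + DU(z)`: EITHER `DW(z)` has a stable direction, OR
`⟪DW(z)w, w⟫ ≥ 0` for all `w` (R41 (E3)(b)/(c) at a point; `z` need not be a node here).
[folklore; cf. ConstantinIgnatovaVicol2026Putative §3.5 proof of Prop 3.9] -/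
theorem stableDirection_or_nonneg_of_curl_eq_zero (h : IsSelfSimilarEulerProfile γ c U P)
    {z : EuclideanSpace ℝ (Fin 3)} (hΩz : curl U z = 0) :
    (∃ v : EuclideanSpace ℝ (Fin 3), v ≠ 0 ∧
        Tendsto (fun t : ℝ => NormedSpace.exp (t • fderiv ℝ (selfSimilarTransport γ c U) z) v) atTop (𝓝 0)) ∨
      (∀ w : EuclideanSpace ℝ (Fin 3), 0 ≤ ⟪fderiv ℝ (selfSimilarTransport γ c U) z w, w⟫) := by
  have hUd := h.differentiable_velocity
  have hDV : fderiv ℝ (selfSimilarTransport γ c U) z =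
      γ • ContinuousLinearMap.id ℝ _ + fderiv ℝ U z :=
    (FluidPDE.hasFDerivAt_selfSimilarTransport hUd z).fderiv
  have hS : ((fderiv ℝ U z : EuclideanSpace ℝ (Fin 3) →L[ℝ] EuclideanSpace ℝ (Fin 3)) :
      EuclideanSpace ℝ (Fin 3) →ₗ[ℝ] EuclideanSpace ℝ (Fin 3)).IsSymmetric :=
    isSymmetric_fderiv_of_curl_eq_zero (hUd z) hΩz
  have hM : ((fderiv ℝ (selfSimilarTransport γ c U) z :
      EuclideanSpace ℝ (Fin 3) →L[ℝ] EuclideanSpace ℝ (Fin 3)) :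
      EuclideanSpace ℝ (Fin 3) →ₗ[ℝ] EuclideanSpace ℝ (Fin 3)).IsSymmetric := by
    rw [hDV]
    intro x y
    have hSxy := hS x y
    simp only [ContinuousLinearMap.coe_coe] at hSxy
    simp only [ContinuousLinearMap.coe_coe, _root_.add_apply,
      FunLike.coe_smul, Pi.smul_apply, ContinuousLinearMap.id_apply,
      inner_add_left, inner_add_right, real_inner_smul_left, real_inner_smul_right]
    rw [hSxy]
  exact stableDirection_or_nonneg_of_isSymmetric _ hM

/-- **THE HOST DICHOTOMY AT A NODE (R41 (E3)/(E4), pointwise).**  `(U, P)` a self-similar Euler profile with `γ < ½` and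
`z` a stagnation point of `W = γ(y−c) + U`.  EITHER `DW(z)` has a STABLE DIRECTION (vortical nodes always do; non-vortical
nodes with a negative eigenvalue), OR `z` is a non-vortical SOURCE: `curl U z = 0`, `DW(z) ⪰ 0`, and then every
stretching rate is subcritical, `⟪DU(z)w, w⟫ ≤ 2γ‖w‖²` (t41a `inner_fderiv_le_two_mul_of_transport_nonneg`, here `c = 0`).
[folklore; cf. ConstantinIgnatovaVicol2026Putative §3.5 Thms 3.8–3.10] -/
theorem stableDirection_or_source_of_mem_nodalSet
    {U : EuclideanSpace ℝ (Fin 3) → EuclideanSpace ℝ (Fin 3)} {P : EuclideanSpace ℝ (Fin 3) → ℝ}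
    (h : IsSelfSimilarEulerProfile γ 0 U P) (hγ2 : γ < 1 / 2)
    {z : EuclideanSpace ℝ (Fin 3)} (hz : z ∈ selfSimilarNodalSet γ 0 U) :
    (∃ v : EuclideanSpace ℝ (Fin 3), v ≠ 0 ∧
        Tendsto (fun t : ℝ => NormedSpace.exp (t • fderiv ℝ (selfSimilarTransport γ 0 U) z) v) atTop (𝓝 0)) ∨
      (curl U z = 0 ∧ (∀ w : EuclideanSpace ℝ (Fin 3), 0 ≤ ⟪fderiv ℝ (selfSimilarTransport γ 0 U) z w, w⟫) ∧
        ∀ w : EuclideanSpace ℝ (Fin 3), ⟪fderiv ℝ U z w, w⟫ ≤ 2 * γ * ‖w‖ ^ 2) := by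
  by_cases hΩz : curl U z = 0
  · rcases stableDirection_or_nonneg_of_curl_eq_zero h hΩz with hst | hpsd
    · exact Or.inl hst
    · exact Or.inr ⟨hΩz, hpsd, inner_fderiv_le_two_mul_of_transport_nonneg h hpsd⟩
  · exact Or.inl (exists_stableDirection_of_vortical_stagnation h hγ2 hz hΩz)

end Summit.NavierStokesRegularity.NavierStokesRegularity.Theorems.PowerGaugeEulerLiouville.Stagnation

end
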